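import Mathlib.GroupTheory.SpecificGroups.Dihedral
import Mathlib.Tactic.Abel
import Mathlib.Tactic.LinearCombination
import Mathlib.Tactic.FinCases
import Mathlib.Data.Fintype.Card
import Mathlib.Data.Fintype.Sum
import Literature.Combinatorics.Additive.TripleProductProperty
import Summits.MatrixMultiplication.OmegaCensus.DihedralLikeLaw
import Summits.MatrixMultiplication.OmegaCensus.DihedralTPPFamilyAllN
import Summits.MatrixMultiplication.OmegaCensus.DicyclicLift
import Summits.MatrixMultiplication.OmegaCensus.DihedralLawMinusOne
import HarnessLib

/-!
# A concrete model of the dihedral-like group `G(A, c₀) = ρ(A) ⊔ τ(A)`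

ω-census, family (b3).  Framing: lottery ticket; floor = certified bounds/negative ranges.

The census's theorems about generalized dihedral / dicyclic groups are stated for an abstract *dihedral-like
presentation* `ρ, τ : A → G` over a finite abelian group `A` with relations
`ρa ρb = ρ(a+b)`, `ρa τb = τ(b−a)`, `τa ρb = τ(a+b)`, `τa τb = ρ(c₀ + b − a)` (so `2c₀ = 0`), `ρ, τ` injective with
disjoint images covering `G`.  Attainment statements, on the other hand, need a concrete group.  This file provides the
concrete model for EVERY pair `(A, c₀)` with `c₀ + c₀ = 0`, in the style of Mathlib's `DihedralGroup` / `QuaternionGroup`: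

* `DihedralLikeGroup A c₀` — the inductive type with constructors `rho a`, `tau a` (`a : A`) and the multiplication above
  (a `Group` under `[Fact (c₀ + c₀ = 0)]`); `Dih(A) = DihedralLikeGroup A 0`, `Q_{4n} ≅ DihedralLikeGroup (ZMod (2n)) n`,
  and e.g. `C₂ × Q₁₆ ≅ DihedralLikeGroup (ZMod 2 × ZMod 8) (0, 4)`, `ℤ₈ ⋊ ℤ₄ ≅ DihedralLikeGroup (ZMod 2 × ZMod 8) (1, 0)`;
* the presentation facts (`rho_injective`, `tau_injective`, `rho_ne_tau`, `rho_or_tau`) and `card = 2|A|`;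
* `tpp_volume_le_law`: the dihedral-like law `|S||T||U| ≤ 4⌊2|A|/3⌋` (`DihedralLikeLaw.lean`) transported to the model.

## First application: the groups `G(ℤ₂ × ℤ_n, (ε, 0))`, `ε ∈ ℤ₂` — `C₂ × D_{2n}` (`ε = 0`) and `ℤ_n ⋊ ℤ₄` (`ε = 1`)

For `A = ℤ₂ × ℤ_n` the dihedral-like groups are `G(A, c₀)` with `2c₀ = 0`.  For `c₀ = (ε, 0)` the element `ρ(1,0)` is
central and `G(A,(ε,0)) / ⟨ρ(1,0)⟩ ≅ D_{2n}`; concretely `π : ρ(i,b) ↦ r b, τ(i,b) ↦ sr b` is a homomorphism onto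
`DihedralGroup n` with kernel `{1, ρ(1,0)}` (`toDihedral`).  Exactly as for `Q_{4n} → D_{2n}` (`DicyclicLift.lean`), every TPP
triple of `D_{2n}` lifts (full preimage of `S`, sections of `T`, `U`) to one of twice the volume (`z2zn_tpp_volume_ge`), so
with the dihedral family `β ≥ 8⌊2n/3⌋` (`z2zn_volume_ge_law`), and with the dihedral-like law (`|A| = 2n`):

* `z2zn_law`: **`β(G(ℤ₂ × ℤ_n, (ε,0))) = 4⌊4n/3⌋` for every `n ≥ 3` with `n ≢ 1 (mod 3)`** and both `ε` — for `ε = 1`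
  this is the group `ℤ_n ⋊ ℤ₄` (`ℤ₄` acting by inversion; `≅ Q_{4n}` for odd `n`, a new isomorphism class for even `n`,
  e.g. `ℤ₈ ⋊ ℤ₄` of order `32`), for `ε = 0` it re-derives `c2_dihedral_law`;
* `z2zn_mod_one_law_attained`: for `n ≡ 2 (mod 3)` (`|A| = 2n ≡ 1 (mod 3)`) the mod-one law `3|S||T||U| + 8 = 8|A|` IS
  attained in `G(ℤ₂ × ℤ_n, (ε, 0))` — the census's '⟸' direction ('`A` has a cyclic subgroup of index `≤ 2` ⟹ attained')
  for this class of groups, by explicit construction (the lifted slack-4 law triple of `D_{2n}`: `2·(8n−4)/3 = (8·2n−8)/3`).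
  By contrast, for `c₀ = (0, n/2)` (`n ≡ 8 (mod 12)`, the groups `C₂ × Q_{2n}`: `|A| = 16, 40, 64, …`) no central quotient is
  dihedral and the census finds NO law triple at `|A| = 16` (group g7, exhaustive) — hypothesis H′, not addressed here;
* `z2zn_window`: for even `n ≡ 1 (mod 3)`, `n ≥ 8` (`|A| ≡ 2 (mod 3)`, `A` not cyclic) the kernel window
  `8⌊2n/3⌋ ≤ β ≤ 8⌊2n/3⌋ + 2` (`tpp_volume_le_law_sub_two_of_not_cyclic`).
-/

namespace Summit.MatrixMultiplication.OmegaCensus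

open Literature.Combinatorics.Additive Finset

/-- **Concrete dihedral-like group** `G(A, c₀)`: elements `rho a` (the abelian index-2 part `ρ(A)`) and `tau a` (the
coset `τ(A)`), `a : A`; multiplication `ρa ρb = ρ(a+b)`, `ρa τb = τ(b−a)`, `τa ρb = τ(a+b)`, `τa τb = ρ(c₀ + b − a)`
(a group when `c₀ + c₀ = 0`). [folklore] -/
inductive DihedralLikeGroup (A : Type) (c₀ : A) : Type
  | rho : A → DihedralLikeGroup A c₀
  | tau : A → DihedralLikeGroup A c₀
  deriving DecidableEq

namespace DihedralLikeGroup

variable {A : Type} [AddCommGroup A] {c₀ : A}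

/-- Multiplication of the model (the four dihedral-like rules). [folklore] -/
private def mul : DihedralLikeGroup A c₀ → DihedralLikeGroup A c₀ → DihedralLikeGroup A c₀
  | rho a, rho b => rho (a + b)
  | rho a, tau b => tau (b - a)
  | tau a, rho b => tau (a + b)
  | tau a, tau b => rho (c₀ + b - a)

/-- Inversion of the model: `(ρa)⁻¹ = ρ(−a)`, `(τa)⁻¹ = τ(a − c₀)`. [folklore] -/
private def inv : DihedralLikeGroup A c₀ → DihedralLikeGroup A c₀
  | rho a => rho (-a)
  | tau a => tau (a - c₀)

/-- **The group structure** on `G(A, c₀)` (associativity of `τττ` is exactly `2c₀ = 0`). [folklore] -/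
instance [Fact (c₀ + c₀ = 0)] : Group (DihedralLikeGroup A c₀) where
  mul := mul
  mul_assoc := by
    have h2 : c₀ + c₀ = 0 := Fact.out
    rintro (a | a) (b | b) (c | c) <;> change mul (mul _ _) _ = mul _ (mul _ _) <;> simp only [mul]
    · rw [add_assoc]
    · congr 1; abel
    · congr 1; abel
    · congr 1; abel
    · rw [add_assoc]
    · congr 1; abel
    · congr 1; abel
    · congr 1; linear_combination (norm := abel1) -h2
  one := rho 0
  one_mul := by
    rintro (a | a)
    · exact congrArg rho (zero_add a)
    · exact congrArg tau (sub_zero a)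
  mul_one := by
    rintro (a | a)
    · exact congrArg rho (add_zero a)
    · exact congrArg tau (add_zero a)
  inv := inv
  inv_mul_cancel := by
    have h2 : c₀ + c₀ = 0 := Fact.out
    rintro (a | a)
    · exact congrArg rho (neg_add_cancel a)
    · change rho (c₀ + a - (a - c₀)) = rho 0
      congr 1; linear_combination (norm := abel1) h2

variable [Fact (c₀ + c₀ = 0)]

/-- `ρa ρb = ρ(a+b)`. [folklore] -/
@[simp] theorem rho_mul_rho (a b : A) : (rho a * rho b : DihedralLikeGroup A c₀) = rho (a + b) := rfl
/-- `ρa τb = τ(b−a)`. [folklore] -/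
@[simp] theorem rho_mul_tau (a b : A) : (rho a * tau b : DihedralLikeGroup A c₀) = tau (b - a) := rfl
/-- `τa ρb = τ(a+b)`. [folklore] -/
@[simp] theorem tau_mul_rho (a b : A) : (tau a * rho b : DihedralLikeGroup A c₀) = tau (a + b) := rfl
/-- `τa τb = ρ(c₀ + b − a)`. [folklore] -/
@[simp] theorem tau_mul_tau (a b : A) : (tau a * tau b : DihedralLikeGroup A c₀) = rho (c₀ + b - a) := rfl
/-- `1 = ρ0`. [folklore] -/
theorem one_def : (1 : DihedralLikeGroup A c₀) = rho 0 := rfl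
/-- `(ρa)⁻¹ = ρ(−a)`. [folklore] -/
@[simp] theorem inv_rho (a : A) : (rho a : DihedralLikeGroup A c₀)⁻¹ = rho (-a) := rfl
/-- `(τa)⁻¹ = τ(a − c₀)`. [folklore] -/
@[simp] theorem inv_tau (a : A) : (tau a : DihedralLikeGroup A c₀)⁻¹ = tau (a - c₀) := rfl

omit [AddCommGroup A] [Fact (c₀ + c₀ = 0)] in
/-- `ρ` is injective. [folklore] -/
theorem rho_injective : Function.Injective (rho : A → DihedralLikeGroup A c₀) := fun _ _ h => rho.inj h

omit [AddCommGroup A] [Fact (c₀ + c₀ = 0)] in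
/-- `τ` is injective. [folklore] -/
theorem tau_injective : Function.Injective (tau : A → DihedralLikeGroup A c₀) := fun _ _ h => tau.inj h

omit [AddCommGroup A] [Fact (c₀ + c₀ = 0)] in
/-- The two cosets are disjoint. [folklore] -/
theorem rho_ne_tau (a b : A) : (rho a : DihedralLikeGroup A c₀) ≠ tau b := fun h => by cases h

omit [AddCommGroup A] [Fact (c₀ + c₀ = 0)] in
/-- The two cosets cover the group. [folklore] -/
theorem rho_or_tau (g : DihedralLikeGroup A c₀) : (∃ a, rho a = g) ∨ (∃ a, tau a = g) := by
  cases g with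
  | rho a => exact Or.inl ⟨a, rfl⟩
  | tau a => exact Or.inr ⟨a, rfl⟩

omit [AddCommGroup A] [Fact (c₀ + c₀ = 0)] in
/-- `G(A, c₀) ≃ A ⊕ A` as types. [folklore] -/
private def sumEquiv : A ⊕ A ≃ DihedralLikeGroup A c₀ where
  toFun x := match x with
    | Sum.inl a => rho a
    | Sum.inr a => tau a
  invFun g := match g with
    | rho a => Sum.inl a
    | tau a => Sum.inr a
  left_inv := by rintro (a | a) <;> rfl
  right_inv := by rintro (a | a) <;> rfl

omit [AddCommGroup A] [Fact (c₀ + c₀ = 0)] in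
/-- `G(A, c₀)` is finite when `A` is. [folklore] -/
instance [Fintype A] : Fintype (DihedralLikeGroup A c₀) := Fintype.ofEquiv _ sumEquiv

omit [AddCommGroup A] [Fact (c₀ + c₀ = 0)] in
/-- `|G(A, c₀)| = 2|A|`. [folklore] -/
theorem card [Fintype A] : Fintype.card (DihedralLikeGroup A c₀) = 2 * Fintype.card A := by
  rw [← Fintype.card_eq.mpr ⟨(sumEquiv : A ⊕ A ≃ DihedralLikeGroup A c₀)⟩, Fintype.card_sum]; ring

/-- **The dihedral-like law in the model**: every TPP triple of `G(A, c₀)` (`|A| ≥ 2`) has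
`|S||T||U| ≤ 4⌊2|A|/3⌋ = 4⌊|G|/3⌋` (`tpp_volume_le_law_dihedralLike`). [folklore] -/
theorem tpp_volume_le_law [Fintype A] [DecidableEq A] (hA : 2 ≤ Fintype.card A)
    {S T U : Finset (DihedralLikeGroup A c₀)} (h : TripleProductProperty S T U) :
    S.card * T.card * U.card ≤ 4 * (2 * Fintype.card A / 3) :=
  tpp_volume_le_law_dihedralLike (ρ := (rho : A → DihedralLikeGroup A c₀)) (τ := tau) (c₀ := c₀) rho_mul_rho
    rho_mul_tau tau_mul_rho tau_mul_tau rho_injective tau_injective rho_ne_tau rho_or_tau hA h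

end DihedralLikeGroup


/-! ## `G(ℤ₂ × ℤ_n, (ε, 0))`: the projection to `D_{2n}` and the lifted dihedral family -/

section Z2Zn

variable {n : ℕ} {ε : ZMod 2}

/-- `2·(ε, 0) = 0` in `ℤ₂ × ℤ_n`, so `G(ℤ₂ × ℤ_n, (ε,0))` is a group. [folklore] -/
instance fact_eps_add_eps (n : ℕ) (ε : ZMod 2) : Fact (((ε, (0 : ZMod n)) : ZMod 2 × ZMod n) + (ε, 0) = 0) :=
  ⟨Prod.ext (by change ε + ε = 0; fin_cases ε <;> decide) (add_zero 0)⟩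

/-- The projection `G(ℤ₂ × ℤ_n, (ε,0)) → D_{2n}`, `ρ(i,b) ↦ r b`, `τ(i,b) ↦ sr b`, as a function. [folklore] -/
private def toDihedralFun : DihedralLikeGroup (ZMod 2 × ZMod n) (ε, 0) → DihedralGroup n
  | .rho a => DihedralGroup.r a.2
  | .tau a => DihedralGroup.sr a.2

/-- The projection is multiplicative (the second coordinate of `c₀ = (ε,0)` is `0`, matching `sr i * sr j = r (j − i)`).
[folklore] -/
private theorem toDihedralFun_mul (x y : DihedralLikeGroup (ZMod 2 × ZMod n) (ε, 0)) :
    toDihedralFun (x * y) = toDihedralFun x * toDihedralFun y := by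
  cases x with
  | rho a =>
    cases y with
    | rho b => simp [toDihedralFun, DihedralGroup.r_mul_r]
    | tau b => simp [toDihedralFun, DihedralGroup.r_mul_sr]
  | tau a =>
    cases y with
    | rho b => simp [toDihedralFun, DihedralGroup.sr_mul_r]
    | tau b => simp [toDihedralFun, DihedralGroup.sr_mul_sr]

/-- **The projection `π : G(ℤ₂ × ℤ_n, (ε,0)) →* D_{2n}`** (kernel `{1, ρ(1,0)}`). [folklore] -/
def toDihedral (n : ℕ) (ε : ZMod 2) : DihedralLikeGroup (ZMod 2 × ZMod n) (ε, 0) →* DihedralGroup n :=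
  MonoidHom.mk' toDihedralFun toDihedralFun_mul

/-- `π(ρ(i,b)) = r b`. [folklore] -/
@[simp] theorem toDihedral_rho (a : ZMod 2 × ZMod n) :
    toDihedral n ε (DihedralLikeGroup.rho a) = DihedralGroup.r a.2 := rfl

/-- `π(τ(i,b)) = sr b`. [folklore] -/
@[simp] theorem toDihedral_tau (a : ZMod 2 × ZMod n) :
    toDihedral n ε (DihedralLikeGroup.tau a) = DihedralGroup.sr a.2 := rfl

/-- **Every TPP triple of `D_{2n}` lifts to `G(ℤ₂ × ℤ_n, (ε,0))` with twice the volume** (full preimage of `S`,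
sections of `T`, `U`; `tpp_lift` of `DicyclicLift.lean`). [folklore] -/
theorem z2zn_tpp_volume_ge {S T U : Finset (DihedralGroup n)} (h : TripleProductProperty S T U) :
    ∃ S' T' U' : Finset (DihedralLikeGroup (ZMod 2 × ZMod n) (ε, 0)), TripleProductProperty S' T' U' ∧
      S'.card * T'.card * U'.card = 2 * (S.card * T.card * U.card) := by
  set π := toDihedral n ε with hπ
  -- a section σ
  let σ : DihedralGroup n → DihedralLikeGroup (ZMod 2 × ZMod n) (ε, 0) := fun g =>
    DihedralGroup.recOn (motive := fun _ => DihedralLikeGroup (ZMod 2 × ZMod n) (ε, 0)) g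
      (fun j => DihedralLikeGroup.rho (0, j)) (fun j => DihedralLikeGroup.tau (0, j))
  have hπσ : ∀ g, π (σ g) = g := by
    intro g
    cases g with
    | r j => rfl
    | sr j => rfl
  have hσinj : Function.Injective σ := fun g g' hgg' => by rw [← hπσ g, ← hπσ g', hgg']
  -- the central element `z = ρ(1,0)` of the kernel
  set z : DihedralLikeGroup (ZMod 2 × ZMod n) (ε, 0) := DihedralLikeGroup.rho (1, 0) with hz
  have hπz : π z = 1 := by rw [hz, hπ, toDihedral_rho, DihedralGroup.one_def]
  have hz1 : z ≠ 1 := by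
    rw [hz, DihedralLikeGroup.one_def]
    intro heq
    have h' : (1 : ZMod 2) = 0 := congrArg Prod.fst (DihedralLikeGroup.rho.inj heq)
    exact absurd h' (by decide)
  refine ⟨S.image σ ∪ S.image (fun s => σ s * z), T.image σ, U.image σ, ?_, ?_⟩
  · refine tpp_lift π h ?_ ?_ ?_ ?_ ?_
    · intro x hx
      rcases mem_union.1 hx with hx | hx
      · obtain ⟨s, hs, rfl⟩ := mem_image.1 hx; rw [hπσ]; exact hs
      · obtain ⟨s, hs, rfl⟩ := mem_image.1 hx; rw [map_mul, hπσ, hπz, mul_one]; exact hs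
    · intro x hx; obtain ⟨t, ht, rfl⟩ := mem_image.1 hx; rw [hπσ]; exact ht
    · intro x hx; obtain ⟨u, hu, rfl⟩ := mem_image.1 hx; rw [hπσ]; exact hu
    · rintro x hx y hy hxy
      obtain ⟨t, -, rfl⟩ := mem_image.1 (mem_coe.1 hx)
      obtain ⟨t', -, rfl⟩ := mem_image.1 (mem_coe.1 hy)
      rw [hπσ, hπσ] at hxy; rw [hxy]
    · rintro x hx y hy hxy
      obtain ⟨u, -, rfl⟩ := mem_image.1 (mem_coe.1 hx)
      obtain ⟨u', -, rfl⟩ := mem_image.1 (mem_coe.1 hy)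
      rw [hπσ, hπσ] at hxy; rw [hxy]
  · have hdisj : Disjoint (S.image σ) (S.image fun s => σ s * z) := by
      rw [disjoint_left]
      intro x hx hx'
      obtain ⟨s, -, rfl⟩ := mem_image.1 hx
      obtain ⟨s', -, hs'⟩ := mem_image.1 hx'
      have : π (σ s' * z) = π (σ s) := by rw [hs']
      rw [map_mul, hπσ, hπσ, hπz, mul_one] at this
      subst this
      exact hz1 (mul_eq_left.mp hs')
    have hinj2 : Function.Injective fun s => σ s * z := fun s s' hss' => hσinj (mul_right_cancel hss')
    rw [card_union_of_disjoint hdisj, card_image_of_injective _ hσinj, card_image_of_injective _ hinj2,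
      card_image_of_injective _ hσinj, card_image_of_injective _ hσinj]
    ring

variable [NeZero n]

/-- **`β(G(ℤ₂ × ℤ_n, (ε,0))) ≥ 8⌊2n/3⌋`** for every `n ≥ 3` (lift of the dihedral family `dihedral_volume_ge_law`).
[folklore] -/
theorem z2zn_volume_ge_law (hn : 3 ≤ n) :
    ∃ S T U : Finset (DihedralLikeGroup (ZMod 2 × ZMod n) (ε, 0)), TripleProductProperty S T U ∧
      S.card * T.card * U.card = 8 * (2 * n / 3) := by
  obtain ⟨S, T, U, h, -, -, -, hvol⟩ := dihedral_volume_ge_law n hn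
  obtain ⟨S', T', U', h', hvol'⟩ := z2zn_tpp_volume_ge (ε := ε) h
  exact ⟨S', T', U', h', by rw [hvol', hvol]; ring⟩

/-- **The dihedral-like law in `G(ℤ₂ × ℤ_n, (ε,0))`**: `|S||T||U| ≤ 4⌊4n/3⌋` for every TPP triple. [folklore] -/
theorem z2zn_tpp_volume_le_law {S T U : Finset (DihedralLikeGroup (ZMod 2 × ZMod n) (ε, 0))}
    (h : TripleProductProperty S T U) : S.card * T.card * U.card ≤ 4 * (4 * n / 3) := by
  have key := DihedralLikeGroup.tpp_volume_le_law (A := ZMod 2 × ZMod n) (c₀ := (ε, 0))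
    (by rw [Fintype.card_prod, ZMod.card, ZMod.card]; have := NeZero.ne n; omega) h
  rw [Fintype.card_prod, ZMod.card, ZMod.card] at key
  have e : 2 * (2 * n) = 4 * n := by ring
  rwa [e] at key

/-- **`β(G(ℤ₂ × ℤ_n, (ε,0))) = 4⌊4n/3⌋` exactly for `n ≥ 3`, `n ≢ 1 (mod 3)`** — for `ε = 1` the groups `ℤ_n ⋊ ℤ₄`, for
`ε = 0` the groups `C₂ × D_{2n}` (both halves kernel: the dihedral-like law and the lifted dihedral family, which agree
since `8⌊2n/3⌋ = 4⌊4n/3⌋` for these `n`). [folklore] -/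
theorem z2zn_law (hn : 3 ≤ n) (hmod : n % 3 ≠ 1) :
    (∀ S T U : Finset (DihedralLikeGroup (ZMod 2 × ZMod n) (ε, 0)), TripleProductProperty S T U →
        S.card * T.card * U.card ≤ 4 * (4 * n / 3)) ∧
    ∃ S T U : Finset (DihedralLikeGroup (ZMod 2 × ZMod n) (ε, 0)), TripleProductProperty S T U ∧
      S.card * T.card * U.card = 4 * (4 * n / 3) := by
  refine ⟨fun S T U h => z2zn_tpp_volume_le_law h, ?_⟩
  obtain ⟨S, T, U, h, hvol⟩ := z2zn_volume_ge_law (ε := ε) hn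
  exact ⟨S, T, U, h, by omega⟩

/-- **The mod-one law is attained in `G(ℤ₂ × ℤ_n, (ε,0))` for `n ≡ 2 (mod 3)`**: with `A = ℤ₂ × ℤ_n`
(`|A| = 2n ≡ 1 (mod 3)`) there is a TPP triple with `3|S||T||U| + 8 = 8|A|`.  This is the '⟸' direction of the census
classification for the groups `C₂ × D_{2n}` (`ε = 0`, known: `c2_dihedral_law`) and `ℤ_n ⋊ ℤ₄` (`ε = 1`, new), i.e. for every
dihedral-like group over `ℤ₂ × ℤ_n` with `c₀ ∈ ℤ₂ × {0}`. [folklore] -/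
theorem z2zn_mod_one_law_attained (hn : 3 ≤ n) (hmod : n % 3 = 2) :
    ∃ S T U : Finset (DihedralLikeGroup (ZMod 2 × ZMod n) (ε, 0)), TripleProductProperty S T U ∧
      3 * (S.card * T.card * U.card) + 8 = 8 * Fintype.card (ZMod 2 × ZMod n) := by
  obtain ⟨S, T, U, h, hvol⟩ := z2zn_volume_ge_law (ε := ε) hn
  refine ⟨S, T, U, h, ?_⟩
  rw [Fintype.card_prod, ZMod.card, ZMod.card, hvol]
  omega

/-- The instance `n = 8`, `ε = 1`: **`ℤ₈ ⋊ ℤ₄ = G(ℤ₂ × ℤ₈, (1,0))` (order `32`) attains the mod-one law**, volume `40`,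
`3·40 + 8 = 128 = 8·16` — whereas its sibling `C₂ × Q₁₆ = G(ℤ₂ × ℤ₈, (0,4))` attains no law triple (census, group g7,
exhaustive search; hypothesis H′). [folklore] -/
theorem z8_semidirect_z4_mod_one_law_attained :
    ∃ S T U : Finset (DihedralLikeGroup (ZMod 2 × ZMod 8) ((1 : ZMod 2), 0)), TripleProductProperty S T U ∧
      S.card * T.card * U.card = 40 := by
  obtain ⟨S, T, U, h, hvol⟩ := z2zn_volume_ge_law (n := 8) (ε := 1) (by norm_num)
  exact ⟨S, T, U, h, by rw [hvol]⟩

/-- **The window for even `n ≡ 1 (mod 3)`, `n ≥ 8`** (`|A| = 2n ≡ 2 (mod 3)`, `A = ℤ₂ × ℤ_n` not cyclic): every TPP triple of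
`G(ℤ₂ × ℤ_n, (ε,0))` has `3|S||T||U| + 10 ≤ 16n` (`tpp_volume_le_law_sub_two_of_not_cyclic`), and `8⌊2n/3⌋` is attained:
`8⌊2n/3⌋ ≤ β ≤ 8⌊2n/3⌋ + 2`. [folklore] -/
theorem z2zn_window (h2 : 2 ∣ n) (hmod : n % 3 = 1) (hn : 8 ≤ n) :
    (∀ S T U : Finset (DihedralLikeGroup (ZMod 2 × ZMod n) (ε, 0)), TripleProductProperty S T U →
        3 * (S.card * T.card * U.card) + 10 ≤ 16 * n) ∧
    ∃ S T U : Finset (DihedralLikeGroup (ZMod 2 × ZMod n) (ε, 0)), TripleProductProperty S T U ∧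
      S.card * T.card * U.card = 8 * (2 * n / 3) := by
  refine ⟨fun S T U h => ?_, z2zn_volume_ge_law (ε := ε) (by omega)⟩
  have key := tpp_volume_le_law_sub_two_of_not_cyclic (A := ZMod 2 × ZMod n)
    (ρ := (DihedralLikeGroup.rho : ZMod 2 × ZMod n → DihedralLikeGroup (ZMod 2 × ZMod n) (ε, 0)))
    (τ := DihedralLikeGroup.tau) (c₀ := (ε, 0)) DihedralLikeGroup.rho_mul_rho DihedralLikeGroup.rho_mul_tau
    DihedralLikeGroup.tau_mul_rho DihedralLikeGroup.tau_mul_tau DihedralLikeGroup.rho_injective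
    DihedralLikeGroup.tau_injective DihedralLikeGroup.rho_ne_tau DihedralLikeGroup.rho_or_tau
    (by rw [Fintype.card_prod, ZMod.card, ZMod.card]; omega)
    (by rw [Fintype.card_prod, ZMod.card, ZMod.card]; omega)
    (by rw [Fintype.card_prod, ZMod.card, ZMod.card]; omega) (not_cyclic_zmod_two_prod h2) h
  rw [Fintype.card_prod, ZMod.card, ZMod.card] at key
  omega

end Z2Zn

end Summit.MatrixMultiplication.OmegaCensus
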